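import HarnessLib
import Summits.RiemannHypothesis.RiemannHypothesis.Theorems.SignConePointwiseTransform

/-!
# Route SignCone: decay and Lipschitz constants of `Ê_χ` (pointwise certificates)

Support for the unconditional rungs of `SignConeOscillatory` / `SignConeInequality`
(items stmt-RiemannHypothesis-16302 / 16301). For the kernel `E_χ` of `SignConePointwiseKernel.lean`:

* `abs_pwT_le`: `|T(x,y)| ≤ e^{x/2}/(¼ + y²)` for `x ≥ 0`, hence the decay
  `|Ê_χ(y)| ≤ decayConst / (¼ + y²)` (`PWKernel.abs_ehatCF_le`) with
  `decayConst = 4[(e^{x_1/2} + e^{x_0/2}) + Σ_k |χ_k| (e^{x_{k-1}/2} + 2e^{x_k/2} + e^{x_{k+1}/2})]/h`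
  — the tail bound of the certificates;
* `PWKernel.absKernel` (`χ_k ↦ |χ_k|`), `abs_kernelE_le_absKernel`, and the Lipschitz constant
  `∫ |x| |E_χ(x)| dx ≤ x_K · Ê_{|χ|}(0)` (`PWKernel.integral_abs_mul_abs_kernelE_le`), so that
  `|Ê_χ(y₁) − Ê_χ(y₂)| ≤ x_K Ê_{|χ|}(0) |y₁ − y₂|` (`abs_cosTransform_sub_le`).
-/

noncomputable section

-- `Summit.RiemannHypothesis.RiemannHypothesis.…` repeats a namespace component by design (D-0017 layout).
set_option linter.dupNamespace false

open Real MeasureTheory Set Filter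

namespace Summit.RiemannHypothesis.RiemannHypothesis.Theorems.SignCone

/-! ## Decay of `T` and of `Ê_χ` -/

/-- `|y| ≤ ¼ + y²`. [folklore] -/
theorem abs_le_quarter_add_sq (y : ℝ) : |y| ≤ 1 / 4 + y ^ 2 := by
  rcases le_or_gt 0 y with h | h
  · rw [abs_of_nonneg h]; nlinarith [sq_nonneg (y - 1 / 2)]
  · rw [abs_of_neg h]; nlinarith [sq_nonneg (y + 1 / 2)]

/-- **`|T(x,y)| ≤ e^{x/2}/(¼ + y²)`** for `x ≥ 0`. [folklore] -/
theorem abs_pwT_le {x : ℝ} (hx : 0 ≤ x) (y : ℝ) : |pwT x y| ≤ Real.exp (x / 2) / (1 / 4 + y ^ 2) := by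
  have hD := quarter_add_sq_pos y
  have hC : 0 ≤ Real.cosh (x / 2) := (Real.cosh_pos _).le
  have hS : 0 ≤ Real.sinh (x / 2) := Real.sinh_nonneg_iff.2 (by linarith)
  have hexp : Real.cosh (x / 2) + Real.sinh (x / 2) = Real.exp (x / 2) := by
    rw [Real.cosh_eq, Real.sinh_eq]; ring
  unfold pwT
  rw [abs_div, abs_of_pos (by positivity : (0 : ℝ) < (1 / 4 + y ^ 2) ^ 2), div_le_div_iff₀ (by positivity) hD]
  have h1 : |(1 / 4 - y ^ 2) * Real.cosh (x / 2) * Real.cos (x * y)| ≤ (1 / 4 + y ^ 2) * Real.cosh (x / 2) := by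
    rw [abs_mul, abs_mul, abs_of_nonneg hC]
    calc |1 / 4 - y ^ 2| * Real.cosh (x / 2) * |Real.cos (x * y)|
        ≤ |1 / 4 - y ^ 2| * Real.cosh (x / 2) * 1 :=
          mul_le_mul_of_nonneg_left (Real.abs_cos_le_one _) (by positivity)
      _ ≤ (1 / 4 + y ^ 2) * Real.cosh (x / 2) * 1 := by
          refine mul_le_mul_of_nonneg_right (mul_le_mul_of_nonneg_right ?_ hC) zero_le_one
          exact abs_sub_le_iff.2 ⟨by nlinarith [sq_nonneg y], by nlinarith [sq_nonneg y]⟩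
      _ = (1 / 4 + y ^ 2) * Real.cosh (x / 2) := mul_one _
  have h2 : |y * Real.sinh (x / 2) * Real.sin (x * y)| ≤ (1 / 4 + y ^ 2) * Real.sinh (x / 2) := by
    rw [abs_mul, abs_mul, abs_of_nonneg hS]
    calc |y| * Real.sinh (x / 2) * |Real.sin (x * y)| ≤ |y| * Real.sinh (x / 2) * 1 :=
          mul_le_mul_of_nonneg_left (Real.abs_sin_le_one _) (by positivity)
      _ ≤ (1 / 4 + y ^ 2) * Real.sinh (x / 2) * 1 :=
          mul_le_mul_of_nonneg_right (mul_le_mul_of_nonneg_right (abs_le_quarter_add_sq y) hS) zero_le_one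
      _ = (1 / 4 + y ^ 2) * Real.sinh (x / 2) := mul_one _
  calc |(1 / 4 - y ^ 2) * Real.cosh (x / 2) * Real.cos (x * y) + y * Real.sinh (x / 2) * Real.sin (x * y)| *
        (1 / 4 + y ^ 2)
      ≤ ((1 / 4 + y ^ 2) * Real.cosh (x / 2) + (1 / 4 + y ^ 2) * Real.sinh (x / 2)) * (1 / 4 + y ^ 2) :=
        mul_le_mul_of_nonneg_right ((abs_add_le _ _).trans (add_le_add h1 h2)) hD.le
    _ = Real.exp (x / 2) * (1 / 4 + y ^ 2) ^ 2 := by rw [← hexp]; ring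

namespace PWKernel

variable {d : PWKernel} (hL : 0 ≤ d.L) (hh : 0 < d.h)

/-- The decay constant `4[(e^{x_1/2} + e^{x_0/2}) + Σ_k |χ_k| (e^{x_{k-1}/2} + 2e^{x_k/2} + e^{x_{k+1}/2})]/h`. [folklore] -/
def decayConst (d : PWKernel) : ℝ :=
  4 * ((Real.exp (d.knot 1 / 2) + Real.exp (d.knot 0 / 2)) / d.h +
    ∑ k ∈ Finset.Ico 1 d.K, |(d.chiAt k : ℝ)| *
      ((Real.exp (d.knot (k - 1) / 2) + 2 * Real.exp (d.knot k / 2) + Real.exp (d.knot (k + 1) / 2)) / d.h))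

include hL hh in
/-- **Decay of the closed form**: `|ehatCF d y| ≤ decayConst d / (¼ + y²)`. [folklore] -/
theorem abs_ehatCF_le (y : ℝ) : |d.ehatCF y| ≤ d.decayConst / (1 / 4 + y ^ 2) := by
  have hD := quarter_add_sq_pos y
  have hh' : (0 : ℝ) < d.h := by exact_mod_cast hh
  have hT : ∀ k : ℕ, |pwT (d.knot k) y| ≤ Real.exp (d.knot k / 2) / (1 / 4 + y ^ 2) :=
    fun k => abs_pwT_le (knot_nonneg hL hh k) y
  unfold ehatCF decayConst
  rw [abs_mul, abs_of_pos (by norm_num : (0 : ℝ) < 4), mul_div_assoc]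
  refine mul_le_mul_of_nonneg_left ?_ (by norm_num)
  rw [add_div, Finset.sum_div]
  refine (abs_add_le _ _).trans (add_le_add ?_ ((Finset.abs_sum_le_sum_abs _ _).trans
    (Finset.sum_le_sum fun k _ => ?_)))
  · rw [abs_div, abs_of_pos hh', div_le_div_iff₀ hh' (by positivity)]
    calc |pwT (d.knot 1) y - pwT (d.knot 0) y| * (1 / 4 + y ^ 2)
        ≤ (Real.exp (d.knot 1 / 2) / (1 / 4 + y ^ 2) + Real.exp (d.knot 0 / 2) / (1 / 4 + y ^ 2)) *
          (1 / 4 + y ^ 2) :=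
          mul_le_mul_of_nonneg_right ((abs_sub _ _).trans (add_le_add (hT 1) (hT 0))) (by positivity)
      _ = (Real.exp (d.knot 1 / 2) + Real.exp (d.knot 0 / 2)) / d.h * d.h := by
          field_simp
  · rw [abs_mul, mul_div_assoc]
    refine mul_le_mul_of_nonneg_left ?_ (abs_nonneg _)
    rw [abs_div, abs_of_pos hh', div_le_div_iff₀ hh' (by positivity)]
    have h3 : |pwT (d.knot (k - 1)) y - 2 * pwT (d.knot k) y + pwT (d.knot (k + 1)) y| ≤
        Real.exp (d.knot (k - 1) / 2) / (1 / 4 + y ^ 2) + 2 * (Real.exp (d.knot k / 2) / (1 / 4 + y ^ 2)) +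
          Real.exp (d.knot (k + 1) / 2) / (1 / 4 + y ^ 2) := by
      refine (abs_add_le _ _).trans (add_le_add ((abs_sub _ _).trans (add_le_add (hT _) ?_)) (hT _))
      rw [abs_mul, abs_of_pos (by norm_num : (0 : ℝ) < 2)]
      exact mul_le_mul_of_nonneg_left (hT k) (by norm_num)
    calc |pwT (d.knot (k - 1)) y - 2 * pwT (d.knot k) y + pwT (d.knot (k + 1)) y| * (1 / 4 + y ^ 2)
        ≤ (Real.exp (d.knot (k - 1) / 2) / (1 / 4 + y ^ 2) + 2 * (Real.exp (d.knot k / 2) / (1 / 4 + y ^ 2)) +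
            Real.exp (d.knot (k + 1) / 2) / (1 / 4 + y ^ 2)) * (1 / 4 + y ^ 2) :=
          mul_le_mul_of_nonneg_right h3 (by positivity)
      _ = (Real.exp (d.knot (k - 1) / 2) + 2 * Real.exp (d.knot k / 2) + Real.exp (d.knot (k + 1) / 2)) / d.h *
            d.h := by
          field_simp

include hL hh in
/-- **Decay of `Ê_χ`**: `|Ê_χ(y)| ≤ decayConst / (¼ + y²)`. [folklore] -/
theorem abs_cosTransform_kernelE_le (y : ℝ) :
    |cosTransform d.kernelE y| ≤ d.decayConst / (1 / 4 + y ^ 2) := by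
  rw [cosTransform_kernelE_eq hL hh]; exact abs_ehatCF_le hL hh y

/-! ## The dominating kernel `E_{|χ|}` and the Lipschitz constant -/

/-- The kernel data with `χ_k ↦ |χ_k|`. [folklore] -/
def absKernel (d : PWKernel) : PWKernel := ⟨d.L, d.h, d.chi.map (fun q => |q|)⟩

/-- `absKernel` has the same `K`. [folklore] -/
@[simp] theorem absKernel_K : d.absKernel.K = d.K := by simp [absKernel, K]

/-- `absKernel` has the same knots. [folklore] -/
@[simp] theorem absKernel_knot (k : ℕ) : d.absKernel.knot k = d.knot k := rfl

/-- `absKernel` has the same `L`, `h`. [folklore] -/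
@[simp] theorem absKernel_L : d.absKernel.L = d.L := rfl

/-- `absKernel` has the same `h`. [folklore] -/
@[simp] theorem absKernel_h : d.absKernel.h = d.h := rfl

/-- `χ⁺_k = |χ_k|`. [folklore] -/
@[simp] theorem absKernel_chiAt (k : ℕ) : d.absKernel.chiAt k = |d.chiAt k| := by
  simp only [absKernel, chiAt]
  rw [List.getD_eq_getElem?_getD, List.getElem?_map, List.getD_eq_getElem?_getD]
  cases d.chi[k - 1]? <;> simp

include hh in
/-- `|χ(t)| ≤ χ⁺(t)` for `t ≥ 0`, where `χ⁺` is the profile of `absKernel`. [folklore] -/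
theorem abs_chiR_le (t : ℝ) : |d.chiR t| ≤ d.absKernel.chiR t := by
  have hh' : (0 : ℝ) < d.h := by exact_mod_cast hh
  unfold chiR
  rw [absKernel_K]
  have hp : 0 ≤ plateau (d.L : ℝ) d.h t := le_max_left _ _
  refine (abs_add_le _ _).trans (add_le_add (by rw [absKernel_L, absKernel_h, abs_of_nonneg hp])
    ((Finset.abs_sum_le_sum_abs _ _).trans (Finset.sum_le_sum fun k _ => ?_)))
  rw [absKernel_chiAt, absKernel_knot, absKernel_h, abs_mul]
  push_cast
  exact mul_le_mul_of_nonneg_left (le_of_eq (abs_of_nonneg (le_max_left _ _))) (abs_nonneg _)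

include hh in
/-- `|E_χ(x)| ≤ E_{|χ|}(x)`. [folklore] -/
theorem abs_kernelE_le_absKernel (x : ℝ) : |d.kernelE x| ≤ d.absKernel.kernelE x := by
  unfold kernelE
  rw [abs_mul, abs_of_pos (by positivity : (0 : ℝ) < Real.exp (|x| / 2) + Real.exp (-(|x| / 2)))]
  exact mul_le_mul_of_nonneg_left (abs_chiR_le hh |x|) (by positivity)

include hL hh in
/-- **The Lipschitz constant**: `∫ |x| |E_χ(x)| dx ≤ x_K · Ê_{|χ|}(0)`. [folklore] -/
theorem integral_abs_mul_abs_kernelE_le :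
    ∫ x : ℝ, |x| * |d.kernelE x| ≤ (d.knot d.K : ℝ) * d.absKernel.ehatCF 0 := by
  have hX : (0 : ℝ) ≤ d.knot d.K := knot_nonneg hL hh _
  have hc' : Continuous d.absKernel.kernelE := continuous_kernelE _
  have hs' : HasCompactSupport d.absKernel.kernelE := hasCompactSupport_kernelE (d := d.absKernel) hh
  -- pointwise domination `|x| |E(x)| ≤ X E⁺(x)`
  have hpt : ∀ x : ℝ, |x| * |d.kernelE x| ≤ (d.knot d.K : ℝ) * d.absKernel.kernelE x := by
    intro x
    rcases le_or_gt (d.knot d.K : ℝ) |x| with h1 | h1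
    · rw [kernelE_eq_zero_of_le_abs hh h1, abs_zero, mul_zero]
      exact mul_nonneg hX ((abs_nonneg _).trans (abs_kernelE_le_absKernel hh x))
    · exact mul_le_mul h1.le (abs_kernelE_le_absKernel hh x) (abs_nonneg _) hX
  have i1 : Integrable fun x : ℝ => |x| * |d.kernelE x| :=
    ((continuous_abs.mul (continuous_abs.comp (continuous_kernelE d))).integrable_of_hasCompactSupport
      ((hasCompactSupport_kernelE hh).norm.mul_left))
  have i2 : Integrable fun x : ℝ => (d.knot d.K : ℝ) * d.absKernel.kernelE x :=
    (hc'.integrable_of_hasCompactSupport hs').const_mul _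
  calc ∫ x : ℝ, |x| * |d.kernelE x| ≤ ∫ x : ℝ, (d.knot d.K : ℝ) * d.absKernel.kernelE x :=
        integral_mono i1 i2 hpt
    _ = (d.knot d.K : ℝ) * cosTransform d.absKernel.kernelE 0 := by
        rw [integral_const_mul]
        unfold cosTransform
        simp
    _ = (d.knot d.K : ℝ) * d.absKernel.ehatCF 0 := by
        rw [cosTransform_kernelE_eq (d := d.absKernel) hL hh]

end PWKernel

end Summit.RiemannHypothesis.RiemannHypothesis.Theorems.SignCone

end
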